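/-
Speedrun cell sr-mbsolver / programme hubbard-alg — LIT team (lit-1 gen-18): THEOREM B, `jw-srot` form, for the RAWLOW relaxation with raw block
`ρ₆` AND STAGGERED CHARGE COMPONENTS (FORMAT-ksdn v0.5 `mps-rawlow` + v0.6 'staggered charge components', the χ12 `nszb` tensors: `m₀ = 7`,
injection `W₅`, bound rule `lmax_psd`, bond labels a PAIR (additive occupation charge, staggered spin charge with the involutive bond rule) —
CERTIFIED #355 / #381 / #399 (U = 8), #405 / #443 (U = 6), #430 (U = 4), #436 / #437 (U = 16 / 12)) — the kernel edge between the BY-VALUE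
node of such a row and the window level. Theorem-only; T2″ of `HOME/sr-mbsolver-lit-1/lean/g16/READY-LEAN-355.md` as re-planned by lit-1 g18
(HOME/sr-mbsolver-lit-1/tools/g18/READY-FOLDS-g18.md §F): NO twirl — the window-side staggered sector zeros are a HYPOTHESIS of the `jw-srot`
window statement with staggered-spin sectors (`Transport/ChainWindowSpinRotationRowsNszb.lean`, `ksdnClaim_of_srotNszbClaim`), which the
standard node discharges through the sublattice spin rotation.
HONEST FRAMING: first certified bounds; not a superconductivity verdict; every number certified or labelled float.

`ksdnSrotNszbClaim_of_mpsRaw6SrotTrClaim` = `ksdnSrotClaim_of_mpsRaw5SrotTrClaim` (`Transport/MPSPrimalRaw5Srot.lean`) with: the raw head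
block `ρ₅` on `{-1,…,3}` replaced by `ρ₆` on `{-1,…,4}` (coordinates `e₆ : Fin 6 ≃ {-1,…,4}`, `i ↦ i − 1`), the injection `W₄` by
`W₅ = cgMap A 5`, the compressed levels by `ω₇…ω_N` (chain rows from `m = 8`); the single additive charge by SITE-INDEXED PAIR charges
`qs : ℕ → Fin 4 → ℤ × ℤ`, `qb : ℕ → β → ℤ × ℤ` with `A^s_{ab} ≠ 0 ⇒ qb (x+1) b = qb x a + qs x s` and
`qs x s = (cb·|occ s| − ca, (−1)^x · cm · ([↑ ∈ occ s] − [↓ ∈ occ s]))` (the second component is the involutive/staggered rule made additive,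
`MPSCoarseGraining.covariantAt_of_involutive`), the `ω`-sector tags by `cgTagAt qs qb 0 (m−2)` (`Literature/…/MPSCoarseGrainingSectorsAt.lean`);
and ONE extra hypothesis on the window variables of both the by-value statement (`ρ₆`) and the concluded window statement (`ρ`): block
diagonality in the STAGGERED spin count `Σ_y ε_y ([↑ ∈ occ k_y] − [↓ ∈ occ k_y])`, `ε_y = −1` on odd / `+1` on even sites. The feasible point is
`exists_mpsRawRowsTr_of_window_loewner_at 5` (`Transport/MPSPrimalRawWindowAt.lean`); the staggered sectors of the relabelled window `ρ^F`
(positions `i`, sign `−(−1)^i` = the parity sign of coordinate `i − 1`) and of the marginal `ρ₆` are inherited from `ρ`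
(`spinPartialTrace_apply_eq_zero_of_chargeAt`). Window `N = n + 3 ≥ 7`. CONCLUSION = the hypothesis `hclaim` of
`Transport.ksdnClaim_of_srotNszbClaim` on `{-1, …, n+1}` with density `ν`. No model beyond `jw-srot`, no definition, no `sorry`, no new
axiom, no named fact.
[cite: KullEtAl2024, §2.3–2.5, §3.3, §4.2, §6.2] [cite: ArakiMoriya2003, §4.1] [cite: PerezGarciaVerstraeteWolfCirac2007, §3.2]
-/
import Summits.Ventures.CertifiedManyBodySolver.Transport.MPSPrimalRawWindowAt
import HarnessLib

noncomputable section

open Matrix Complex Filter Topology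
open scoped ComplexOrder Kronecker BigOperators MatrixOrder
open Literature.Probability.LatticeModels
open Literature.MathematicalPhysics.QuantumLattice
open Literature.MathematicalPhysics.QuantumLattice.HubbardWave0
open Literature.MathematicalPhysics.QuantumLattice.ThermodynamicLimit
open Literature.MathematicalPhysics.QuantumLattice.JordanWigner
open Literature.MathematicalPhysics.QuantumManyBody.StateRelaxation
open Literature.MathematicalPhysics.QuantumLattice.MPSCoarseGraining
open Literature.Computability.QuantumComplexity (traceLeft traceRight)

namespace Summit.Ventures.CertifiedManyBodySolver.Transport

/-! ### The six-site raw window `{-1, 0, 1, 2, 3, 4}` -/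

section Window6

/-- `{-1,…,3} ⊆ {-1,…,4}`. [folklore] -/
theorem chainWindow_three_subset_four : chainWindow (-1) 3 ⊆ chainWindow (-1) 4 := chainWindow_mono_right (-1) (by norm_num)

/-- The unit translate of `{-1,…,3}` lies in `{-1,…,4}`. [folklore] -/
theorem affShiftSet_chainWindow_three_subset_four : affShiftSet 1 (unitVec 0) (chainWindow (-1) 3) ⊆ chainWindow (-1) 4 :=
  affShiftSet_chainWindow_subset (-1) 3

/-- `-e₀ ∈ {-1,…,4}`. [folklore] -/
theorem neg_unitVec_mem_chainWindow_four : (-unitVec 0 : Site 1) ∈ chainWindow (-1) 4 := neg_unitVec_mem_chainWindow (by norm_num)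

/-- `0 ∈ {-1,…,4}`. [folklore] -/
theorem zero_mem_chainWindow_four : (0 : Site 1) ∈ chainWindow (-1) 4 := zero_mem_chainWindow (by norm_num)

end Window6

/-! ### THEOREM B, `jw-srot` form, RAWLOW with raw block `ρ₆` and staggered-spin sectors: the `mps-rawlow(N, D, A)` statement implies the `jw-srot` window statement with staggered sectors -/

section Transport

variable {β : Type*} [Fintype β] [DecidableEq β]

/-- **THEOREM B, `jw-srot` form, RAWLOW with raw block `ρ₆`, `W₅`, `λ_max` bounds AND STAGGERED-SPIN SECTORS, edge form.** Data: window
`N = n+3 ≥ 7` sites; a REAL MPS tensor `A = (A^s)_{s ∈ Fin 4}` on the bond index type `β`, covariant for the SITE-INDEXED PAIR charges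
`qs x s = (cb·|occ(s)| − ca, (−1)^x·cm·([↑ ∈ occ s] − [↓ ∈ occ s]))` with bond charges `qb : ℕ → β → ℤ × ℤ`; a-priori bounds `B_m ≥ 0` with
`W_{m−2}ᴴW_{m−2} ≤ B_m·𝟙` (`m = k+7 ≤ N`); coordinates `e₆ : Fin 6 ≃ {-1,…,4}`, `i ↦ i − 1`. HYPOTHESIS `hclaim` = the by-value node of a
`hubbard_jwsrot` `mps-rawlow` row with staggered charge components: over `ρ₆ : Op (PolySite {-1,…,4}) 4` and `ω₇, …, ω_N` — `ρ₆ ⪰ 0`,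
`tr ρ₆ = 1`, LTI `tr_{-1} ρ₆ = tr_{4} ρ₆`, TOTAL-OCCUPATION sector zeros, STAGGERED-SPIN sector zeros, total density of site `-1` equal to `ν`,
real entries, `|ρ₆| ≤ 1`; E7L/E7R with `ρ₆` read through `e₆` then as (first five, last) / (first, last five) and `W₅ = cgMap A 5`; E_mL/E_mR
(`m = k+8 ≤ N`); `ω_m ⪰ 0`, `cgTagAt qs qb 0 (m−2)` sectors, real, `|ω_m| ≤ B_m`, `Re tr ω_m ≤ B_m` (`m = k+7 ≤ N`); conclusion
`E ≤ Re tr(toSpin(U n_{-1↑}n_{-1↓} − t Σ_σ (c†_{-1σ} c_{0σ̄} + c†_{0σ̄} c_{-1σ})) ρ₆)`. CONCLUSION: the hypothesis `hclaim` of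
`Transport.ksdnClaim_of_srotNszbClaim` on `{-1, …, n+1}` with density `ν` (the `jw-srot` window statement with staggered-spin sectors).
[cite: KullEtAl2024, §2.3–2.5, §3.3, §4.2, §6.2] [cite: ArakiMoriya2003, §4.1] -/
theorem ksdnSrotNszbClaim_of_mpsRaw6SrotTrClaim (t U : ℝ) (n : ℕ) (hn : 4 ≤ n) (A : Fin 4 → Matrix β β ℂ)
    (hAreal : ∀ s a b, star (A s a b) = A s a b) (qs : ℕ → Fin 4 → ℤ × ℤ) (qb : ℕ → β → ℤ × ℤ) (cb ca cm : ℤ)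
    (hqs : ∀ x s, qs x s = (cb * ((siteOcc s).card : ℤ) - ca,
      (-1 : ℤ) ^ x * cm * ((if (0 : Fin 2) ∈ siteOcc s then 1 else 0 : ℤ) - (if (1 : Fin 2) ∈ siteOcc s then 1 else 0 : ℤ))))
    (hAcov : ∀ x s a b, A s a b ≠ 0 → qb (x + 1) b = qb x a + qs x s)
    (B : ℕ → ℝ) (hB : ∀ k, k + 7 ≤ n + 3 → 0 ≤ B (k + 7) ∧
      (cgMap A (k + 5))ᴴ * cgMap A (k + 5) ≤ B (k + 7) • (1 : Matrix (Fin (k + 5) → Fin 4) (Fin (k + 5) → Fin 4) ℂ))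
    (e₆ : Fin 6 ≃ PolySite (chainWindow (-1) 4)) (he₆ : ∀ i, ofLex (e₆ i).1 0 = ((i : ℕ) : ℤ) - 1)
    {ν E : ℝ}
    (hclaim : ∀ (ρ₆ : Op (PolySite (chainWindow (-1) 4)) 4)
        (ω : ℕ → Matrix (Fin 4 × ((β × β) × Fin 4)) (Fin 4 × ((β × β) × Fin 4)) ℂ),
      ρ₆.PosSemidef → ρ₆.trace = 1 →
      spinPartialTrace ((PolySite.affEmb 1 (unitVec 0) (chainWindow (-1) 3)).trans
          (PolySite.incl affShiftSet_chainWindow_three_subset_four)) ρ₆ =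
        spinPartialTrace (PolySite.incl chainWindow_three_subset_four) ρ₆ →
      (∀ k k' : TensorIndex (PolySite (chainWindow (-1) 4)) 4,
        (∑ x, (siteOcc (k x)).card) ≠ (∑ x, (siteOcc (k' x)).card) → ρ₆ k k' = 0) →
      (∀ k k' : TensorIndex (PolySite (chainWindow (-1) 4)) 4,
        (∑ y : PolySite (chainWindow (-1) 4), (if Odd (ofLex y.1 0) then (-1 : ℤ) else 1) *
            ((if (0 : Fin 2) ∈ siteOcc (k y) then 1 else 0 : ℤ) - (if (1 : Fin 2) ∈ siteOcc (k y) then 1 else 0 : ℤ))) ≠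
          (∑ y : PolySite (chainWindow (-1) 4), (if Odd (ofLex y.1 0) then (-1 : ℤ) else 1) *
            ((if (0 : Fin 2) ∈ siteOcc (k' y) then 1 else 0 : ℤ) - (if (1 : Fin 2) ∈ siteOcc (k' y) then 1 else 0 : ℤ))) →
        ρ₆ k k' = 0) →
      ((toSpin (nAt (-unitVec 0) neg_unitVec_mem_chainWindow_four 0 +
          nAt (-unitVec 0) neg_unitVec_mem_chainWindow_four 1) * ρ₆).trace).re = ν →
      (∀ k k' : TensorIndex (PolySite (chainWindow (-1) 4)) 4, starRingEnd ℂ (ρ₆ k k') = ρ₆ k k') →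
      (∀ k k' : TensorIndex (PolySite (chainWindow (-1) 4)) 4, ‖ρ₆ k k'‖ ≤ 1) →
      traceLeft (ω 7) = (cgMap A 5 ⊗ₖ (1 : Matrix (Fin 4) (Fin 4) ℂ)) *
          (ρ₆.submatrix (Equiv.arrowCongr e₆ (Equiv.refl (Fin 4))) (Equiv.arrowCongr e₆ (Equiv.refl (Fin 4)))).submatrix
            ((Equiv.prodComm _ _).trans (Fin.snocEquiv fun _ => Fin 4))
            ((Equiv.prodComm _ _).trans (Fin.snocEquiv fun _ => Fin 4)) *
        (cgMap A 5 ⊗ₖ (1 : Matrix (Fin 4) (Fin 4) ℂ))ᴴ →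
      traceRight ((ω 7).submatrix (Equiv.prodAssoc _ _ _) (Equiv.prodAssoc _ _ _)) =
        ((1 : Matrix (Fin 4) (Fin 4) ℂ) ⊗ₖ cgMap A 5) *
          (ρ₆.submatrix (Equiv.arrowCongr e₆ (Equiv.refl (Fin 4))) (Equiv.arrowCongr e₆ (Equiv.refl (Fin 4)))).submatrix
            (Fin.consEquiv fun _ => Fin 4) (Fin.consEquiv fun _ => Fin 4) *
        ((1 : Matrix (Fin 4) (Fin 4) ℂ) ⊗ₖ cgMap A 5)ᴴ →
      (∀ k, k + 8 ≤ n + 3 → traceLeft (ω (k + 8)) =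
        (leftMap A ⊗ₖ (1 : Matrix (Fin 4) (Fin 4) ℂ)) *
          (ω (k + 7)).submatrix (Equiv.prodAssoc _ _ _) (Equiv.prodAssoc _ _ _) *
        (leftMap A ⊗ₖ (1 : Matrix (Fin 4) (Fin 4) ℂ))ᴴ) →
      (∀ k, k + 8 ≤ n + 3 → traceRight ((ω (k + 8)).submatrix (Equiv.prodAssoc _ _ _) (Equiv.prodAssoc _ _ _)) =
        ((1 : Matrix (Fin 4) (Fin 4) ℂ) ⊗ₖ rightMap A) * ω (k + 7) *
        ((1 : Matrix (Fin 4) (Fin 4) ℂ) ⊗ₖ rightMap A)ᴴ) →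
      (∀ k, k + 7 ≤ n + 3 → (ω (k + 7)).PosSemidef) →
      (∀ k, k + 7 ≤ n + 3 → ∀ i j, cgTagAt qs qb 0 (k + 5) i ≠ cgTagAt qs qb 0 (k + 5) j → ω (k + 7) i j = 0) →
      (∀ k, k + 7 ≤ n + 3 → ∀ i j, starRingEnd ℂ (ω (k + 7) i j) = ω (k + 7) i j) →
      (∀ k, k + 7 ≤ n + 3 → ∀ i j, ‖ω (k + 7) i j‖ ≤ B (k + 7)) →
      (∀ k, k + 7 ≤ n + 3 → ((ω (k + 7)).trace).re ≤ B (k + 7)) →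
      E ≤ ((toSpin ((U : ℂ) • (nAt (-unitVec 0) neg_unitVec_mem_chainWindow_four 0 *
            nAt (-unitVec 0) neg_unitVec_mem_chainWindow_four 1) +
          (-(t : ℂ)) • ∑ σ : Fin 2,
            ((cAt (-unitVec 0) neg_unitVec_mem_chainWindow_four σ)ᴴ *
                cAt 0 zero_mem_chainWindow_four σ.rev +
              (cAt 0 zero_mem_chainWindow_four σ.rev)ᴴ *
                cAt (-unitVec 0) neg_unitVec_mem_chainWindow_four σ)) * ρ₆).trace).re) :
    ∀ ρ : Op (PolySite (chainWindow (-1) ((n : ℤ) + 1))) 4, ρ.PosSemidef → ρ.trace = 1 →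
      spinPartialTrace ((PolySite.affEmb 1 (unitVec 0) (chainWindow (-1) (n : ℤ))).trans
          (PolySite.incl (affShiftSet_chainWindow_subset (-1) (n : ℤ)))) ρ =
        spinPartialTrace (PolySite.incl (chainWindow_mono_right (-1) (by omega : (n : ℤ) ≤ n + 1))) ρ →
      (∀ k k' : TensorIndex (PolySite (chainWindow (-1) ((n : ℤ) + 1))) 4,
        (∑ x, (siteOcc (k x)).card) ≠ (∑ x, (siteOcc (k' x)).card) → ρ k k' = 0) →
      (∀ k k' : TensorIndex (PolySite (chainWindow (-1) ((n : ℤ) + 1))) 4,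
        (∑ y : PolySite (chainWindow (-1) ((n : ℤ) + 1)), (if Odd (ofLex y.1 0) then (-1 : ℤ) else 1) *
            ((if (0 : Fin 2) ∈ siteOcc (k y) then 1 else 0 : ℤ) - (if (1 : Fin 2) ∈ siteOcc (k y) then 1 else 0 : ℤ))) ≠
          (∑ y : PolySite (chainWindow (-1) ((n : ℤ) + 1)), (if Odd (ofLex y.1 0) then (-1 : ℤ) else 1) *
            ((if (0 : Fin 2) ∈ siteOcc (k' y) then 1 else 0 : ℤ) - (if (1 : Fin 2) ∈ siteOcc (k' y) then 1 else 0 : ℤ))) →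
        ρ k k' = 0) →
      ((toSpin (nAt (-unitVec 0) (neg_unitVec_mem_chainWindow (by omega : (-1 : ℤ) ≤ n + 1)) 0 +
          nAt (-unitVec 0) (neg_unitVec_mem_chainWindow (by omega : (-1 : ℤ) ≤ n + 1)) 1) * ρ).trace).re = ν →
      (∀ k k' : TensorIndex (PolySite (chainWindow (-1) ((n : ℤ) + 1))) 4, starRingEnd ℂ (ρ k k') = ρ k k') →
      (∀ k k' : TensorIndex (PolySite (chainWindow (-1) ((n : ℤ) + 1))) 4, ‖ρ k k'‖ ≤ 1) →
      E ≤ ((toSpin ((U : ℂ) • (nAt (-unitVec 0) (neg_unitVec_mem_chainWindow (by omega : (-1 : ℤ) ≤ n + 1)) 0 *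
            nAt (-unitVec 0) (neg_unitVec_mem_chainWindow (by omega : (-1 : ℤ) ≤ n + 1)) 1) +
          (-(t : ℂ)) • ∑ σ : Fin 2,
            ((cAt (-unitVec 0) (neg_unitVec_mem_chainWindow (by omega : (-1 : ℤ) ≤ n + 1)) σ)ᴴ *
                cAt 0 (zero_mem_chainWindow (by omega : (0 : ℤ) ≤ n + 1)) σ.rev +
              (cAt 0 (zero_mem_chainWindow (by omega : (0 : ℤ) ≤ n + 1)) σ.rev)ᴴ *
                cAt (-unitVec 0) (neg_unitVec_mem_chainWindow (by omega : (-1 : ℤ) ≤ n + 1)) σ)) * ρ).trace).re := by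
  intro ρ hpsd htr hLTI hsec hstag hdens hreal _hbd
  classical
  -- the windows `W₆ = {-1,…,4} ⊆ W = {-1,…,n+1}` and the shifts of the LTI embeddings
  have hW6 : chainWindow (-1) 4 ⊆ chainWindow (-1) ((n : ℤ) + 1) := chainWindow_mono_right (-1) (by omega)
  have hlow6 : IsLowerSet (Set.range (PolySite.incl hW6)) := isLowerSet_range_incl_chainWindow hW6
  have hφ₀ := shift_incl (chainWindow_mono_right (-1) (by omega : (n : ℤ) ≤ n + 1))
  have hφ₁ : ∀ y, ofLex (((PolySite.affEmb 1 (unitVec 0) (chainWindow (-1) (n : ℤ))).trans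
      (PolySite.incl (affShiftSet_chainWindow_subset (-1) (n : ℤ)))) y).1 0 = ofLex y.1 0 + 1 := fun y => by
    rw [shift_affEmb_trans_incl, chain_unitVec_apply_zero]
  -- (i) coordinates and the relabelled window variable `ρ^F`
  obtain ⟨eN, heN⟩ := exists_finEquiv_chainWindow (n + 3) ((n : ℤ) + 1) (by push_cast; ring)
  obtain ⟨e', he'⟩ := exists_finEquiv_chainWindow (n + 2) (n : ℤ) (by push_cast; ring)
  set ρF : Op (Fin (n + 3)) 4 := spinPartialTrace eN.toEmbedding ρ with hρFdef
  have hFpsd : ρF.PosSemidef := posSemidef_spinPartialTrace _ hpsd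
  have hFtr : ρF.trace = 1 := by rw [hρFdef, trace_spinPartialTrace, htr]
  have hsucc : (Fin.succEmb (n + 2)).trans eN.toEmbedding =
      e'.toEmbedding.trans ((PolySite.affEmb 1 (unitVec 0) (chainWindow (-1) (n : ℤ))).trans
        (PolySite.incl (affShiftSet_chainWindow_subset (-1) (n : ℤ)))) := by
    refine embedding_eq_of_coord_eq fun i => ?_
    rw [Function.Embedding.trans_apply, Function.Embedding.trans_apply, Equiv.coe_toEmbedding, Equiv.coe_toEmbedding, heN,
      hφ₁, he', Fin.coe_succEmb, Fin.val_succ]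
    push_cast
    ring
  have hcast : (Fin.castSuccEmb : Fin (n + 2) ↪ Fin (n + 3)).trans eN.toEmbedding =
      e'.toEmbedding.trans (PolySite.incl (chainWindow_mono_right (-1) (by omega : (n : ℤ) ≤ n + 1))) := by
    refine embedding_eq_of_coord_eq fun i => ?_
    rw [Function.Embedding.trans_apply, Function.Embedding.trans_apply, Equiv.coe_toEmbedding, Equiv.coe_toEmbedding, heN,
      hφ₀, he', Fin.coe_castSuccEmb, Fin.val_castSucc, add_zero]
  have hFLTI : spinPartialTrace (Fin.succEmb (n + 2)) ρF = spinPartialTrace Fin.castSuccEmb ρF := by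
    rw [hρFdef, ← spinPartialTrace_trans, ← spinPartialTrace_trans, hsucc, hcast, spinPartialTrace_trans e'.toEmbedding,
      spinPartialTrace_trans e'.toEmbedding, hLTI]
  have hFsecN : ∀ k k' : TensorIndex (Fin (n + 3)) 4,
      (∑ x, (siteOcc (k x)).card) ≠ (∑ x, (siteOcc (k' x)).card) → ρF k k' = 0 :=
    fun k k' h => spinPartialTrace_apply_eq_zero_of_charge (fun s : Fin 4 => (siteOcc s).card) eN.toEmbedding hsec h
  -- staggered-spin sectors of `ρ^F`: the big window's parity sign read at position `i` is `-(-1)^i` (coordinate `i - 1`)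
  have hsign : ∀ i : Fin (n + 3), (if Odd (ofLex (eN i).1 0) then (-1 : ℤ) else 1) = -((-1 : ℤ) ^ (i : ℕ)) := by
    intro i
    rw [heN]
    rcases Nat.even_or_odd (i : ℕ) with h | h
    · rw [h.neg_one_pow, if_pos]
      rcases h with ⟨r, hr⟩
      exact ⟨(r : ℤ) - 1, by omega⟩
    · rw [h.neg_one_pow, neg_neg, if_neg]
      rcases h with ⟨r, hr⟩
      rintro ⟨r', hr'⟩
      omega
  -- the two scalar charges of a configuration of the relabelled window
  have hpair : ∀ w : TensorIndex (Fin (n + 3)) 4, (∑ x : Fin (n + 3), qs (x : ℕ) (w x)) =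
      (∑ x : Fin (n + 3), (fun s : Fin 4 => cb * ((siteOcc s).card : ℤ) - ca) (w x),
        (-cm) * ∑ i : Fin (n + 3), (-((-1 : ℤ) ^ (i : ℕ))) *
          ((if (0 : Fin 2) ∈ siteOcc (w i) then 1 else 0 : ℤ) - (if (1 : Fin 2) ∈ siteOcc (w i) then 1 else 0 : ℤ))) := by
    intro w
    rw [Prod.ext_iff, Prod.fst_sum, Prod.snd_sum, Finset.mul_sum]
    refine ⟨Finset.sum_congr rfl fun x _ => by rw [hqs], Finset.sum_congr rfl fun x _ => by rw [hqs]; ring⟩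
  have hFstag : ∀ u v : TensorIndex (Fin (n + 3)) 4,
      (∑ i : Fin (n + 3), (-((-1 : ℤ) ^ (i : ℕ))) *
          ((if (0 : Fin 2) ∈ siteOcc (u i) then 1 else 0 : ℤ) - (if (1 : Fin 2) ∈ siteOcc (u i) then 1 else 0 : ℤ))) ≠
        (∑ i : Fin (n + 3), (-((-1 : ℤ) ^ (i : ℕ))) *
          ((if (0 : Fin 2) ∈ siteOcc (v i) then 1 else 0 : ℤ) - (if (1 : Fin 2) ∈ siteOcc (v i) then 1 else 0 : ℤ))) →
      ρF u v = 0 := by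
    intro u v huv
    refine spinPartialTrace_apply_eq_zero_of_chargeAt
      (fun (y : PolySite (chainWindow (-1) ((n : ℤ) + 1))) (s : Fin 4) => (if Odd (ofLex y.1 0) then (-1 : ℤ) else 1) *
        ((if (0 : Fin 2) ∈ siteOcc s then 1 else 0 : ℤ) - (if (1 : Fin 2) ∈ siteOcc s then 1 else 0 : ℤ)))
      eN.toEmbedding hstag ?_
    simpa only [Equiv.coe_toEmbedding, hsign] using huv
  have hFsec : ∀ u v : TensorIndex (Fin (n + 3)) 4,
      (∑ x : Fin (n + 3), qs (x : ℕ) (u x)) ≠ (∑ x : Fin (n + 3), qs (x : ℕ) (v x)) → ρF u v = 0 := by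
    intro u v huv
    by_contra hne
    apply huv
    have h0 : (∑ x, (fun s : Fin 4 => cb * ((siteOcc s).card : ℤ) - ca) (u x)) =
        ∑ x, (fun s : Fin 4 => cb * ((siteOcc s).card : ℤ) - ca) (v x) := by
      by_contra h
      exact hne (apply_eq_zero_of_sum_srotCharge_ne cb ca hFsecN u v h)
    have h1 : (∑ i : Fin (n + 3), (-((-1 : ℤ) ^ (i : ℕ))) *
          ((if (0 : Fin 2) ∈ siteOcc (u i) then 1 else 0 : ℤ) - (if (1 : Fin 2) ∈ siteOcc (u i) then 1 else 0 : ℤ))) =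
        ∑ i : Fin (n + 3), (-((-1 : ℤ) ^ (i : ℕ))) *
          ((if (0 : Fin 2) ∈ siteOcc (v i) then 1 else 0 : ℤ) - (if (1 : Fin 2) ∈ siteOcc (v i) then 1 else 0 : ℤ)) := by
      by_contra h
      exact hne (hFstag u v h)
    rw [hpair, hpair, h0, h1]
  have hFstar : ∀ u v, star (ρF u v) = ρF u v := fun u v => by
    have := conj_spinPartialTrace_apply eN.toEmbedding hreal u v
    rwa [starRingEnd_apply] at this
  -- (ii) the model-independent core: KSDN's `ω_m = C_{m−2}(ρ^F|_{first m})`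
  obtain ⟨ω, hE4L, hE4R, hEmL, hEmR, hωpsd, hωsec, hωreal, hωbd, hωtr⟩ :=
    exists_mpsRawRowsTr_of_window_loewner_at 5 (n + 1) (by norm_num) (show 5 ≤ n + 1 by omega) A hAreal qs qb hAcov B hB ρF hFpsd hFtr hFLTI hFsec hFstar
  -- (iii) the six-site marginal `ρ₆` and its rows
  set ρ₆ : Op (PolySite (chainWindow (-1) 4)) 4 := spinPartialTrace (PolySite.incl hW6) ρ with hρ₆def
  have h6psd : ρ₆.PosSemidef := posSemidef_spinPartialTrace _ hpsd
  have h6tr : ρ₆.trace = 1 := by rw [hρ₆def, trace_spinPartialTrace, htr]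
  have h6LTI : spinPartialTrace ((PolySite.affEmb 1 (unitVec 0) (chainWindow (-1) 3)).trans
        (PolySite.incl affShiftSet_chainWindow_three_subset_four)) ρ₆ =
      spinPartialTrace (PolySite.incl chainWindow_three_subset_four) ρ₆ := by
    rw [hρ₆def, ← spinPartialTrace_trans, ← spinPartialTrace_trans]
    refine spinPartialTrace_eq_of_shift hφ₀ hφ₁ hLTI 1 ?_ ?_
    · intro y
      rw [shift_trans (shift_affEmb_trans_incl (unitVec (0 : Fin 1)) affShiftSet_chainWindow_three_subset_four)
        (shift_incl hW6), chain_unitVec_apply_zero]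
      push_cast
      ring
    · intro y
      rw [shift_trans (shift_incl chainWindow_three_subset_four) (shift_incl hW6), add_zero]
  have h6sec : ∀ k k' : TensorIndex (PolySite (chainWindow (-1) 4)) 4,
      (∑ x, (siteOcc (k x)).card) ≠ (∑ x, (siteOcc (k' x)).card) → ρ₆ k k' = 0 :=
    fun k k' h => spinPartialTrace_apply_eq_zero_of_charge (fun s : Fin 4 => (siteOcc s).card) (PolySite.incl hW6) hsec h
  have h6stag : ∀ k k' : TensorIndex (PolySite (chainWindow (-1) 4)) 4,
      (∑ y : PolySite (chainWindow (-1) 4), (if Odd (ofLex y.1 0) then (-1 : ℤ) else 1) *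
          ((if (0 : Fin 2) ∈ siteOcc (k y) then 1 else 0 : ℤ) - (if (1 : Fin 2) ∈ siteOcc (k y) then 1 else 0 : ℤ))) ≠
        (∑ y : PolySite (chainWindow (-1) 4), (if Odd (ofLex y.1 0) then (-1 : ℤ) else 1) *
          ((if (0 : Fin 2) ∈ siteOcc (k' y) then 1 else 0 : ℤ) - (if (1 : Fin 2) ∈ siteOcc (k' y) then 1 else 0 : ℤ))) →
      ρ₆ k k' = 0 := by
    intro k k' h
    refine spinPartialTrace_apply_eq_zero_of_chargeAt
      (fun (y : PolySite (chainWindow (-1) ((n : ℤ) + 1))) (s : Fin 4) => (if Odd (ofLex y.1 0) then (-1 : ℤ) else 1) *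
        ((if (0 : Fin 2) ∈ siteOcc s then 1 else 0 : ℤ) - (if (1 : Fin 2) ∈ siteOcc s then 1 else 0 : ℤ)))
      (PolySite.incl hW6) hstag ?_
    exact h
  have h6dens : ((toSpin (nAt (-unitVec 0) neg_unitVec_mem_chainWindow_four 0 +
      nAt (-unitVec 0) neg_unitVec_mem_chainWindow_four 1) * ρ₆).trace).re = ν := by
    rw [hρ₆def, trace_toSpin_mul_spinPartialTrace_incl hW6 hlow6, fermionEmbed_add, fermionEmbed_incl_nAt,
      fermionEmbed_incl_nAt]
    exact hdens
  have h6real : ∀ k k' : TensorIndex (PolySite (chainWindow (-1) 4)) 4, starRingEnd ℂ (ρ₆ k k') = ρ₆ k k' :=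
    fun k k' => conj_spinPartialTrace_apply (PolySite.incl hW6) hreal k k'
  have h6bd : ∀ k k' : TensorIndex (PolySite (chainWindow (-1) 4)) 4, ‖ρ₆ k k'‖ ≤ 1 :=
    norm_apply_le_one_of_posSemidef h6psd h6tr
  -- `ρ^F|_{first 6}` is `ρ₆` read through `e₆`
  have hemb : (Fin.castLEEmb (show 5 + 1 ≤ n + 3 by omega)).trans eN.toEmbedding =
      e₆.toEmbedding.trans (PolySite.incl hW6) := by
    refine embedding_eq_of_coord_eq fun i => ?_
    rw [Function.Embedding.trans_apply, Function.Embedding.trans_apply, Equiv.coe_toEmbedding, Equiv.coe_toEmbedding, heN,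
      Fin.castLEEmb_apply, Fin.val_castLE]
    change _ = ofLex (e₆ i).1 0
    rw [he₆]
  have hlink : headMarginal (show 5 + 1 ≤ n + 1 + 2 by omega) ρF =
      ρ₆.submatrix (Equiv.arrowCongr e₆ (Equiv.refl (Fin 4))) (Equiv.arrowCongr e₆ (Equiv.refl (Fin 4))) := by
    rw [headMarginal, hρFdef, ← spinPartialTrace_trans, hemb, spinPartialTrace_trans, spinPartialTrace_equiv]
    ext u v
    rw [reindexOp_apply, Matrix.submatrix_apply]
    rfl
  rw [hlink] at hE4L hE4R
  -- (iv) apply the `mps` claim and move the objective back to the big window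
  have hE := hclaim ρ₆ ω h6psd h6tr h6LTI h6sec h6stag h6dens h6real h6bd hE4L hE4R hEmL hEmR hωpsd hωsec hωreal hωbd hωtr
  rw [hρ₆def, trace_toSpin_mul_spinPartialTrace_incl hW6 hlow6] at hE
  simp only [fermionEmbed_add, fermionEmbed_smul, fermionEmbed_sum, fermionEmbed_mul, fermionEmbed_conjTranspose,
    fermionEmbed_incl_nAt, fermionEmbed_incl_cAt] at hE
  exact hE

end Transport

end Summit.Ventures.CertifiedManyBodySolver.Transport

end
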